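import Summits.CriticalPhenomena.PercolationContinuityZ3.Theorems.SahiMasterFamilyHFlatLin

/-!
# The bilinear form `B_k(h, β)` and the typed conjecture BILIN(k) — the common roof of H♭-LIN and SDH♭-LIN;
# `BILIN ⟹ H♭-LIN`, `BILIN ⟹ SDH♭-LIN` (hence `⟹ SDH♭ ⟹ H♭ ⟹ (UC-hull) ⟹ (GH)`), and BILIN(3), BILIN(4) in the kernel

Unit `prim-masterthm-p4` (gen 19; crux anchor stmt-CriticalPhenomena-4575, helper work; memo
`run/shared/lean/prim/prim-masterthm/prim-masterthm-p4/DELETION-PICTURE.md` §8–§9 and `P4-GEN19-REPORT.md` §1).  Companion of `…HFlatLin`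
(typed H♭-LIN / SDH♭-LIN, Identity 2.2), `…SDHFlat`, `…SDHFlatThree`, `…SDHFlatFour`.

For set functions `h, β` on `Fin k` put (`κ_B(β) = blockCoef β B`, `= 1` at `univ`, `= −Φ_{Bᶜ}(β|)` otherwise; `cap_t β` = `β` with every set through `t` set to one)
   `B_k(h, β) := −Σ_B |B|·(|B|−1)!·h_B·κ_B(β) + Σ_t h_{t}·Φ_k(cap_t β)`   (`bil h β`).
In the memo's notation (`d = 1 − β`, `W_R(d) = Σ_{σ∈Sym R}∏_c d_c`, `A_R = Σ_x W_{R∖x}`, `Φ_R = A_R − W_R`) this is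
`B_k(h,d) = Σ_{∅≠S⊊T} h_S·c_d(S) − k!·h_univ` with `c_d(S) = |S|!·Φ_{T∖S}(d)` (`|S| ≥ 2`), `c_d({t}) = A_{T∖t}(d)`, equivalently
`B_k(h,d) = Σ_{|U|≥2} (|U|−1)!·W_{T∖U}(d)·δ_h(U)`, `δ_h(U) = Σ_{y∈U} h_{U∖y} − |U|·h_U` (the square-free generating function
`[x^T] e^D((s−1)·H + H₁)`).  It is LINEAR in `h` and multi-affine in `β`, and it specialises to both gen-18 functionals:
* `bil_one_sub`:   `B(1 − β, β) = k·Φ_k(β) − Σ_t β_{t}·Φ_k(cap_t β)` — the H♭ functional (`SDHFlat.hFlat_lhs_eq_sum_blockCoef`);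
* `bil_indicator`: `B(1 − 1_𝒢, β) = Λ(𝒢, β)` for every family `𝒢` — the SDH♭ functional (Identity 2.2, `SDHFlat.lam_eq_sum_caps_sub_sum_sdiff`).
**CONJECTURE BILIN(k)** (`SDHFlat.Bilin k`, conjecture-valued definition, never a fact): `B_k(h, β) ≥ 0` for every `h ≥ 0` that is
SUBADDITIVE (`h_{S∪T} ≤ h_S + h_T`) with `h_univ = 0`, and every `β` in the linear relaxation `Q_k` (box, `β_univ = 1`, pairwise union
`β_S + β_T ≤ 1 + β_{S∪T}`).  Since `1 − β` is subadditive exactly when `β` satisfies pairwise union, and `1 − 1_𝒢` is subadditive exactly when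
`𝒢` is union-closed: **`hFlatLin_of_bilin : Bilin k → HFlatLin k`** and **`sdhFlatLin_of_bilin : Bilin k → SDHFlatLin k`**, so BILIN(k) sits
above the whole gen-18 ladder (`⟹ SDH♭(k) ⟹ H♭(k) ⟹ (UC-hull)_k ⟹ (GH)_k = PC-k`, `ucHullNonneg_of_bilin`).  Kernel: `bilin_three` (on the bare
box, closed form `bil_three_eq`) and `bilin_four` (closed form `bil_four_eq` + the LOC′(3) charging of `…SDHFlatFour`, which used of `1 − 1_𝒢` only
nonnegativity and subadditivity and therefore runs verbatim for real `h`).  EVIDENCE (memo §9; kit j176629/j176630/j176778/j176829/j176938/j176940):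
LP-minimum of `h ↦ B_k(h,d)` equal to 0 at ≈ 2 000 random and adversarial relaxation points for k = 5, 6 (its two natural sub-cones die: SPLIT at
k = 5, PEEL at k = 6); Farkas form = a `d`-dependent routing of the deficits `−c_d(S) > 0` down the union hypergraph.  HONEST FRAMING: a typed
conjecture with its kernel reductions and its two smallest cases; BILIN(k) (k ≥ 5), H♭-LIN/SDH♭-LIN (k ≥ 5), SDH♭/H♭ (k ≥ 5), (UC-hull)_k (k ≥ 8),
Sahi's `C_k` and the master theorem remain OPEN.  Axioms standard. [this work]
-/

noncomputable section

open scoped Classical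

namespace Summit.CriticalPhenomena.PercolationContinuityZ3.Theorems

namespace SDHFlat

open Finset
open Literature.Combinatorics.Sahi2008
open PrincipalCapBeta (phiSet)
open HFlat (HFlatLin HFlatNonneg)
open GHConjecture (UCHullNonneg)

variable {k : ℕ}

/-- **The bilinear form** `B_k(h, β) := −Σ_B |B|·(|B|−1)!·h_B·κ_B(β) + Σ_t h_{t}·Φ_k(cap_t β)` (linear in `h`, multi-affine in `β`). [this work] -/
def bil (h β : Finset (Fin k) → ℝ) : ℝ :=
  -∑ B : Finset (Fin k), ((B.card : ℝ) * ((B.card - 1).factorial : ℝ)) * (h B * blockCoef β B)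
    + ∑ t : Fin k, h {t} * phiSet k (fun S => if t ∈ S then 1 else β S)

/-- **Conjecture BILIN(k)**: `B_k(h, β) ≥ 0` for every nonnegative subadditive `h` vanishing at `univ` and every `β` in the linear relaxation
(box, top, pairwise union).  A conjecture-valued definition, never a fact. [this work] [status: kernel k ≤ 4; LP-alive k = 5, 6; open k ≥ 5] -/
@[conjecture] def Bilin (k : ℕ) : Prop :=
  ∀ h : Finset (Fin k) → ℝ, (∀ S, 0 ≤ h S) → (∀ S T : Finset (Fin k), h (S ∪ T) ≤ h S + h T) → h univ = 0 →
    ∀ β : Finset (Fin k) → ℝ, (∀ B, 0 ≤ β B) → (∀ B, β B ≤ 1) → β univ = 1 → (∀ S T : Finset (Fin k), β S + β T ≤ 1 + β (S ∪ T)) →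
      0 ≤ bil h β

/-! ### The two specialisations -/

/-- **`B(1 − β, β)` is the H♭ functional**: `B_{k+1}(1 − β, β) = (k+1)·Φ(β) − Σ_t β_{t}·Φ(cap_t β)`. [this work] -/
theorem bil_one_sub (β : Finset (Fin (k + 1)) → ℝ) :
    bil (fun S => 1 - β S) β =
      ((k + 1 : ℕ) : ℝ) * phiSet (k + 1) β - ∑ t : Fin (k + 1), β {t} * phiSet (k + 1) (fun S => if t ∈ S then 1 else β S) := by
  rw [hFlat_lhs_eq_sum_blockCoef]
  rfl

/-- **`B(1 − 1_𝒢, β) = Λ(𝒢, β)`** for every family `𝒢` (Identity 2.2). [this work] -/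
theorem bil_indicator (𝒢 : Finset (Finset (Fin (k + 1)))) (β : Finset (Fin (k + 1)) → ℝ) :
    bil (fun S => if S ∈ 𝒢 then (0 : ℝ) else 1) β = lam 𝒢 β := by
  rw [lam_eq_sum_caps_sub_sum_sdiff]
  unfold bil
  have e : ∀ B : Finset (Fin (k + 1)),
      ((B.card : ℝ) * ((B.card - 1).factorial : ℝ)) * ((if B ∈ 𝒢 then (0 : ℝ) else 1) * blockCoef β B) =
        if B ∈ univ \ 𝒢 then ((B.card : ℝ) * ((B.card - 1).factorial : ℝ)) * blockCoef β B else 0 := by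
    intro B
    by_cases hB : B ∈ 𝒢
    · rw [if_pos hB, if_neg (fun h => (mem_sdiff.1 h).2 hB)]; ring
    · rw [if_neg hB, if_pos (mem_sdiff.2 ⟨mem_univ B, hB⟩)]; ring
  rw [sum_congr rfl fun B _ => e B, sum_ite_mem, univ_inter]
  ring

/-! ### The ladder: BILIN above H♭-LIN and SDH♭-LIN -/

/-- **BILIN(k) ⟹ H♭-LIN(k)** (`h = 1 − β` is nonnegative, subadditive and vanishes at `univ` on the relaxation). [this work] -/
theorem hFlatLin_of_bilin (hB : Bilin k) : HFlatLin k := by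
  rcases Nat.eq_zero_or_pos k with hk | hk
  · subst hk
    intro β _ _ _ _
    simp
  · obtain ⟨k', rfl⟩ : ∃ k', k = k' + 1 := ⟨k - 1, (Nat.sub_add_cancel hk).symm⟩
    intro β h0 h1 huniv hu
    have hh0 : ∀ S, 0 ≤ 1 - β S := fun S => sub_nonneg.2 (h1 S)
    have hsub : ∀ S T : Finset (Fin (k' + 1)), 1 - β (S ∪ T) ≤ (1 - β S) + (1 - β T) := fun S T => by linarith [hu S T]
    have htop : 1 - β univ = 0 := by rw [huniv, sub_self]
    have := hB (fun S => 1 - β S) hh0 hsub htop β h0 h1 huniv hu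
    rw [bil_one_sub] at this
    linarith

/-- **BILIN(k) ⟹ SDH♭-LIN(k)** (`h = 1 − 1_𝒢` is nonnegative, subadditive iff `𝒢` is union-closed, and vanishes at `univ ∈ 𝒢`). [this work] -/
theorem sdhFlatLin_of_bilin (hB : Bilin k) : SDHFlatLin k := by
  rcases Nat.eq_zero_or_pos k with hk | hk
  · subst hk
    intro 𝒢 _ _ β _ _ _ _
    have hc : ∀ B : Finset (Fin 0), B.card = 0 := fun B => by simp [Finset.eq_empty_of_isEmpty B]
    simp [lam, hyb, hc]
  · obtain ⟨k', rfl⟩ : ∃ k', k = k' + 1 := ⟨k - 1, (Nat.sub_add_cancel hk).symm⟩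
    intro 𝒢 hG hGtop β h0 h1 huniv hu
    have hh0 : ∀ S, 0 ≤ (if S ∈ 𝒢 then (0 : ℝ) else 1) := fun S => by split_ifs <;> norm_num
    have hsub : ∀ S T : Finset (Fin (k' + 1)),
        (if S ∪ T ∈ 𝒢 then (0 : ℝ) else 1) ≤ (if S ∈ 𝒢 then (0 : ℝ) else 1) + (if T ∈ 𝒢 then (0 : ℝ) else 1) := by
      intro S T
      by_cases hS : S ∈ 𝒢
      · by_cases hT : T ∈ 𝒢
        · rw [if_pos hS, if_pos hT, if_pos (hG S hS T hT)]; norm_num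
        · rw [if_neg hT]; split_ifs <;> norm_num
      · rw [if_neg hS]; split_ifs <;> norm_num
    have htop : (if (univ : Finset (Fin (k' + 1))) ∈ 𝒢 then (0 : ℝ) else 1) = 0 := if_pos hGtop
    have := hB _ hh0 hsub htop β h0 h1 huniv hu
    rwa [bil_indicator] at this

/-- Down the ladder: **BILIN(k) ⟹ SDH♭(k)**. [this work] -/
theorem sdhFlatNonneg_of_bilin (hB : Bilin k) : SDHFlatNonneg k := sdhFlatNonneg_of_sdhFlatLin (sdhFlatLin_of_bilin hB)

/-- Down the ladder: **BILIN(k) ⟹ H♭(k)**. [this work] -/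
theorem hFlatNonneg_of_bilin (hB : Bilin k) : HFlatNonneg k := HFlat.hFlatNonneg_of_hFlatLin (hFlatLin_of_bilin hB)

/-- Down the ladder: **BILIN(k) ⟹ (UC-hull)_k** (hence `(GH)_k` = PC-k). [this work] -/
theorem ucHullNonneg_of_bilin (hB : Bilin k) : UCHullNonneg k := HFlat.ucHullNonneg_of_hFlatLin (hFlatLin_of_bilin hB)

/-- `BILIN(k) ⟹ (GH)_k`. [this work] -/
theorem gSystemNonneg_of_bilin (hB : Bilin k) : GHConjecture.GSystemNonneg k :=
  GHConjecture.gSystemNonneg_of_ucHullNonneg (ucHullNonneg_of_bilin hB)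

/-! ### Three points -/

/-- **`B_3(h, β)` in closed form**: `Σ_t h_{t}·(2 − Σ_{z≠t}β_z) + 2·Σ_{ab} h_{ab}·β_{c} − 6·h_univ` (every `c_d(S) ≥ 0` on the box). [this work] -/
theorem bil_three_eq (h β : Finset (Fin 3) → ℝ) :
    bil h β = h {0} * (2 - β {1} - β {2}) + h {1} * (2 - β {0} - β {2}) + h {2} * (2 - β {0} - β {1})
      + 2 * (h {0, 1} * β {2} + h {0, 2} * β {1} + h {1, 2} * β {0}) - 6 * h univ := by
  have κu : blockCoef β (univ : Finset (Fin 3)) = 1 := blockCoef_univ β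
  have κ01 : blockCoef β ({0, 1} : Finset (Fin 3)) = -β {2} :=
    blockCoef_of_compl_eq_singleton (k := 2) β (by decide)
  have κ02 : blockCoef β ({0, 2} : Finset (Fin 3)) = -β {1} :=
    blockCoef_of_compl_eq_singleton (k := 2) β (by decide)
  have κ12 : blockCoef β ({1, 2} : Finset (Fin 3)) = -β {0} :=
    blockCoef_of_compl_eq_singleton (k := 2) β (by decide)
  have κ0 : blockCoef β ({0} : Finset (Fin 3)) = β {1} * β {2} - β {1, 2} :=
    blockCoef_of_compl_eq_pair (k := 2) β (by decide) (by decide)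
  have κ1 : blockCoef β ({1} : Finset (Fin 3)) = β {0} * β {2} - β {0, 2} :=
    blockCoef_of_compl_eq_pair (k := 2) β (by decide) (by decide)
  have κ2 : blockCoef β ({2} : Finset (Fin 3)) = β {0} * β {1} - β {0, 1} :=
    blockCoef_of_compl_eq_pair (k := 2) β (by decide) (by decide)
  have c01 : ({0, 1} : Finset (Fin 3)).card = 2 := by decide
  have c02 : ({0, 2} : Finset (Fin 3)).card = 2 := by decide
  have c12 : ({1, 2} : Finset (Fin 3)).card = 2 := by decide
  have cu : (univ : Finset (Fin 3)).card = 3 := by rw [card_univ, Fintype.card_fin]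
  have hcap : ∀ t : Fin 3, phiSet 3 (fun S => if t ∈ S then 1 else β S) =
      ∑ B : Finset (Fin 3), (if t ∈ B then ((B.card - 1).factorial : ℝ) * blockCoef β B else 0) :=
    fun t => phiSet_cap_eq_sum_blockCoef (k := 2) β t
  have f2 : Nat.factorial 2 = 2 := rfl
  unfold bil
  rw [Fin.sum_univ_three, hcap 0, hcap 1, hcap 2, sum_finset_fin_three, sum_finset_fin_three, sum_finset_fin_three,
    sum_finset_fin_three]
  simp +decide only [Fin.isValue, if_true, if_false, card_empty,
    card_singleton, c01, c02, c12, cu, κu, κ01, κ02, κ12, κ0, κ1, κ2, Nat.cast_zero, zero_mul, Nat.cast_one,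
    Nat.cast_ofNat, Nat.factorial_zero, Nat.factorial_one, f2, Nat.sub_self, Nat.add_one_sub_one, one_mul, mul_one]
  ring

/-- **BILIN(3)**, indeed on the bare box and for every `h ≥ 0` with `h_univ = 0` (no subadditivity needed). [this work] -/
theorem bilin_three : Bilin 3 := by
  intro h hh0 _ htop β h0 h1 _ _
  rw [bil_three_eq, htop]
  have a0 := h0 {0}; have a1 := h0 {1}; have a2 := h0 {2}
  have b0 := h1 {0}; have b1 := h1 {1}; have b2 := h1 {2}
  have g0 := hh0 {0}; have g1 := hh0 {1}; have g2 := hh0 {2}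
  have g01 := hh0 {0, 1}; have g02 := hh0 {0, 2}; have g12 := hh0 {1, 2}
  nlinarith [mul_nonneg g0 (show 0 ≤ 2 - β {1} - β {2} by linarith), mul_nonneg g1 (show 0 ≤ 2 - β {0} - β {2} by linarith),
    mul_nonneg g2 (show 0 ≤ 2 - β {0} - β {1} by linarith), mul_nonneg g01 a2, mul_nonneg g02 a1, mul_nonneg g12 a0]

/-! ### Four points -/

/-- Charging a pair term to its two points, for real weights: if `0 ≤ h_{ab} ≤ h_a + h_b` then
`(h_a + h_b)·2·min(0,X) ≤ h_{ab}·2X`. [this work] -/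
theorem pair_charge' {ha hb hab X : ℝ} (h0 : 0 ≤ hab) (hsub : hab ≤ ha + hb) :
    (ha + hb) * (2 * min 0 X) ≤ hab * (2 * X) := by
  rcases le_or_gt 0 X with hX | hX
  · rw [min_eq_left hX]
    nlinarith [mul_nonneg h0 hX]
  · rw [min_eq_right hX.le]
    nlinarith [mul_le_mul_of_nonpos_right hsub (by linarith : 2 * X ≤ 0)]

/-- **`B_4(h, β)` in closed form** (`= Σ_S h_S·c_d(S) − 24·h_univ`, all sixteen coefficients visible): co-dimension-1 sets get `6β_z`, pairs get
`2(β_{cd} − β_cβ_d)` (`cd` the complementary pair), points get the link bracket `6 − 2Σ_{z≠t}β_z − Σ_{pq⊆T∖t}(β_{pq} − β_pβ_q)`. [this work] -/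
theorem bil_four_eq (h β : Finset (Fin 4) → ℝ) :
    bil h β =
      (h {1, 2, 3} * (6 * β {0}) + h {0, 2, 3} * (6 * β {1}) + h {0, 1, 3} * (6 * β {2}) + h {0, 1, 2} * (6 * β {3}))
      + (h {0, 1} * (2 * (β {2, 3} - β {2} * β {3})) + h {0, 2} * (2 * (β {1, 3} - β {1} * β {3}))
        + h {0, 3} * (2 * (β {1, 2} - β {1} * β {2})) + h {1, 2} * (2 * (β {0, 3} - β {0} * β {3}))
        + h {1, 3} * (2 * (β {0, 2} - β {0} * β {2})) + h {2, 3} * (2 * (β {0, 1} - β {0} * β {1})))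
      + (h {0} * (6 - 2 * (β {1} + β {2} + β {3}) - ((β {1, 2} - β {1} * β {2}) + (β {1, 3} - β {1} * β {3}) + (β {2, 3} - β {2} * β {3})))
        + h {1} * (6 - 2 * (β {0} + β {2} + β {3}) - ((β {0, 2} - β {0} * β {2}) + (β {0, 3} - β {0} * β {3}) + (β {2, 3} - β {2} * β {3})))
        + h {2} * (6 - 2 * (β {0} + β {1} + β {3}) - ((β {0, 1} - β {0} * β {1}) + (β {0, 3} - β {0} * β {3}) + (β {1, 3} - β {1} * β {3})))
        + h {3} * (6 - 2 * (β {0} + β {1} + β {2}) - ((β {0, 1} - β {0} * β {1}) + (β {0, 2} - β {0} * β {2}) + (β {1, 2} - β {1} * β {2}))))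
      - 24 * h univ := by
  have κu : blockCoef β (univ : Finset (Fin 4)) = 1 := blockCoef_univ β
  have κ012 : blockCoef β ({0, 1, 2} : Finset (Fin 4)) = -β {3} :=
    blockCoef_of_compl_eq_singleton (k := 3) β (by decide)
  have κ013 : blockCoef β ({0, 1, 3} : Finset (Fin 4)) = -β {2} :=
    blockCoef_of_compl_eq_singleton (k := 3) β (by decide)
  have κ023 : blockCoef β ({0, 2, 3} : Finset (Fin 4)) = -β {1} :=
    blockCoef_of_compl_eq_singleton (k := 3) β (by decide)
  have κ123 : blockCoef β ({1, 2, 3} : Finset (Fin 4)) = -β {0} :=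
    blockCoef_of_compl_eq_singleton (k := 3) β (by decide)
  have κ01 : blockCoef β ({0, 1} : Finset (Fin 4)) = β {2} * β {3} - β {2, 3} :=
    blockCoef_of_compl_eq_pair (k := 3) β (by decide) (by decide)
  have κ02 : blockCoef β ({0, 2} : Finset (Fin 4)) = β {1} * β {3} - β {1, 3} :=
    blockCoef_of_compl_eq_pair (k := 3) β (by decide) (by decide)
  have κ03 : blockCoef β ({0, 3} : Finset (Fin 4)) = β {1} * β {2} - β {1, 2} :=
    blockCoef_of_compl_eq_pair (k := 3) β (by decide) (by decide)
  have κ12 : blockCoef β ({1, 2} : Finset (Fin 4)) = β {0} * β {3} - β {0, 3} :=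
    blockCoef_of_compl_eq_pair (k := 3) β (by decide) (by decide)
  have κ13 : blockCoef β ({1, 3} : Finset (Fin 4)) = β {0} * β {2} - β {0, 2} :=
    blockCoef_of_compl_eq_pair (k := 3) β (by decide) (by decide)
  have κ23 : blockCoef β ({2, 3} : Finset (Fin 4)) = β {0} * β {1} - β {0, 1} :=
    blockCoef_of_compl_eq_pair (k := 3) β (by decide) (by decide)
  have c01 : ({0, 1} : Finset (Fin 4)).card = 2 := by decide
  have c02 : ({0, 2} : Finset (Fin 4)).card = 2 := by decide
  have c03 : ({0, 3} : Finset (Fin 4)).card = 2 := by decide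
  have c12 : ({1, 2} : Finset (Fin 4)).card = 2 := by decide
  have c13 : ({1, 3} : Finset (Fin 4)).card = 2 := by decide
  have c23 : ({2, 3} : Finset (Fin 4)).card = 2 := by decide
  have c012 : ({0, 1, 2} : Finset (Fin 4)).card = 3 := by decide
  have c013 : ({0, 1, 3} : Finset (Fin 4)).card = 3 := by decide
  have c023 : ({0, 2, 3} : Finset (Fin 4)).card = 3 := by decide
  have c123 : ({1, 2, 3} : Finset (Fin 4)).card = 3 := by decide
  have cu : (univ : Finset (Fin 4)).card = 4 := by rw [card_univ, Fintype.card_fin]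
  have f2 : Nat.factorial 2 = 2 := rfl
  have f3 : Nat.factorial 3 = 6 := rfl
  have hcap : ∀ t : Fin 4, phiSet 4 (fun S => if t ∈ S then 1 else β S) =
      ∑ B : Finset (Fin 4), (if t ∈ B then ((B.card - 1).factorial : ℝ) * blockCoef β B else 0) :=
    fun t => phiSet_cap_eq_sum_blockCoef (k := 3) β t
  unfold bil
  rw [Fin.sum_univ_four, hcap 0, hcap 1, hcap 2, hcap 3, sum_finset_fin_four, sum_finset_fin_four, sum_finset_fin_four,
    sum_finset_fin_four, sum_finset_fin_four]
  simp +decide only [Fin.isValue, if_true, if_false, card_empty,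
    card_singleton, c01, c02, c03, c12, c13, c23, c012, c013, c023, c123, cu, κu, κ012, κ013, κ023, κ123, κ01, κ02, κ03, κ12, κ13, κ23, Nat.cast_zero, zero_mul, Nat.cast_one,
    Nat.cast_ofNat, Nat.factorial_zero, Nat.factorial_one, f2, f3, Nat.sub_self, Nat.add_one_sub_one, one_mul, mul_one]
  ring

/-- **BILIN(4) on the linear relaxation**: `B_4(h, β) ≥ 0` for every nonnegative subadditive `h` with `h_univ = 0` and every `0 ≤ β ≤ 1` with the
pairwise-union inequalities (the LOC′(3) charging of `lam_four_nonneg_of_pairUnion`, run for real `h`). [this work] -/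
theorem bil_four_nonneg_of_pairUnion (h : Finset (Fin 4) → ℝ) (hh0 : ∀ S, 0 ≤ h S) (hsub : ∀ S T : Finset (Fin 4), h (S ∪ T) ≤ h S + h T)
    (htop : h univ = 0) (β : Finset (Fin 4) → ℝ) (h0 : ∀ B, 0 ≤ β B) (h1 : ∀ B, β B ≤ 1)
    (hu : ∀ S T : Finset (Fin 4), β S + β T ≤ 1 + β (S ∪ T)) : 0 ≤ bil h β := by
  rw [bil_four_eq h β, htop]
  have e01 : ({0} : Finset (Fin 4)) ∪ {1} = {0, 1} := by decide
  have u01 : β {0} + β {1} ≤ 1 + β {0, 1} := by have := hu {0} {1}; rwa [e01] at this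
  have w01 : h {0, 1} ≤ h {0} + h {1} := by have := hsub {0} {1}; rwa [e01] at this
  have e02 : ({0} : Finset (Fin 4)) ∪ {2} = {0, 2} := by decide
  have u02 : β {0} + β {2} ≤ 1 + β {0, 2} := by have := hu {0} {2}; rwa [e02] at this
  have w02 : h {0, 2} ≤ h {0} + h {2} := by have := hsub {0} {2}; rwa [e02] at this
  have e03 : ({0} : Finset (Fin 4)) ∪ {3} = {0, 3} := by decide
  have u03 : β {0} + β {3} ≤ 1 + β {0, 3} := by have := hu {0} {3}; rwa [e03] at this
  have w03 : h {0, 3} ≤ h {0} + h {3} := by have := hsub {0} {3}; rwa [e03] at this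
  have e12 : ({1} : Finset (Fin 4)) ∪ {2} = {1, 2} := by decide
  have u12 : β {1} + β {2} ≤ 1 + β {1, 2} := by have := hu {1} {2}; rwa [e12] at this
  have w12 : h {1, 2} ≤ h {1} + h {2} := by have := hsub {1} {2}; rwa [e12] at this
  have e13 : ({1} : Finset (Fin 4)) ∪ {3} = {1, 3} := by decide
  have u13 : β {1} + β {3} ≤ 1 + β {1, 3} := by have := hu {1} {3}; rwa [e13] at this
  have w13 : h {1, 3} ≤ h {1} + h {3} := by have := hsub {1} {3}; rwa [e13] at this
  have e23 : ({2} : Finset (Fin 4)) ∪ {3} = {2, 3} := by decide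
  have u23 : β {2} + β {3} ≤ 1 + β {2, 3} := by have := hu {2} {3}; rwa [e23] at this
  have w23 : h {2, 3} ≤ h {2} + h {3} := by have := hsub {2} {3}; rwa [e23] at this
  have q01 : (h {0} + h {1}) * (2 * min 0 (β {2, 3} - β {2} * β {3})) ≤ h {0, 1} * (2 * (β {2, 3} - β {2} * β {3})) :=
    pair_charge' (hh0 {0, 1}) w01
  have q02 : (h {0} + h {2}) * (2 * min 0 (β {1, 3} - β {1} * β {3})) ≤ h {0, 2} * (2 * (β {1, 3} - β {1} * β {3})) :=
    pair_charge' (hh0 {0, 2}) w02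
  have q03 : (h {0} + h {3}) * (2 * min 0 (β {1, 2} - β {1} * β {2})) ≤ h {0, 3} * (2 * (β {1, 2} - β {1} * β {2})) :=
    pair_charge' (hh0 {0, 3}) w03
  have q12 : (h {1} + h {2}) * (2 * min 0 (β {0, 3} - β {0} * β {3})) ≤ h {1, 2} * (2 * (β {0, 3} - β {0} * β {3})) :=
    pair_charge' (hh0 {1, 2}) w12
  have q13 : (h {1} + h {3}) * (2 * min 0 (β {0, 2} - β {0} * β {2})) ≤ h {1, 3} * (2 * (β {0, 2} - β {0} * β {2})) :=
    pair_charge' (hh0 {1, 3}) w13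
  have q23 : (h {2} + h {3}) * (2 * min 0 (β {0, 1} - β {0} * β {1})) ≤ h {2, 3} * (2 * (β {0, 1} - β {0} * β {1})) :=
    pair_charge' (hh0 {2, 3}) w23
  have x01 : β {0} * β {1} - 1 ≤ -(β {0, 1} - β {0} * β {1}) + 2 * min 0 (β {0, 1} - β {0} * β {1}) :=
    absX_le (h0 {0}) (h1 {0}) (h0 {1}) (h1 {1}) (h1 {0, 1}) u01
  have x02 : β {0} * β {2} - 1 ≤ -(β {0, 2} - β {0} * β {2}) + 2 * min 0 (β {0, 2} - β {0} * β {2}) :=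
    absX_le (h0 {0}) (h1 {0}) (h0 {2}) (h1 {2}) (h1 {0, 2}) u02
  have x03 : β {0} * β {3} - 1 ≤ -(β {0, 3} - β {0} * β {3}) + 2 * min 0 (β {0, 3} - β {0} * β {3}) :=
    absX_le (h0 {0}) (h1 {0}) (h0 {3}) (h1 {3}) (h1 {0, 3}) u03
  have x12 : β {1} * β {2} - 1 ≤ -(β {1, 2} - β {1} * β {2}) + 2 * min 0 (β {1, 2} - β {1} * β {2}) :=
    absX_le (h0 {1}) (h1 {1}) (h0 {2}) (h1 {2}) (h1 {1, 2}) u12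
  have x13 : β {1} * β {3} - 1 ≤ -(β {1, 3} - β {1} * β {3}) + 2 * min 0 (β {1, 3} - β {1} * β {3}) :=
    absX_le (h0 {1}) (h1 {1}) (h0 {3}) (h1 {3}) (h1 {1, 3}) u13
  have x23 : β {2} * β {3} - 1 ≤ -(β {2, 3} - β {2} * β {3}) + 2 * min 0 (β {2, 3} - β {2} * β {3}) :=
    absX_le (h0 {2}) (h1 {2}) (h0 {3}) (h1 {3}) (h1 {2, 3}) u23
  have l0 : 0 ≤ 6 - 2 * (β {1} + β {2} + β {3}) - ((β {1, 2} - β {1} * β {2}) + (β {1, 3} - β {1} * β {3}) + (β {2, 3} - β {2} * β {3}))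
      + 2 * (min 0 (β {1, 2} - β {1} * β {2}) + min 0 (β {1, 3} - β {1} * β {3}) + min 0 (β {2, 3} - β {2} * β {3})) :=
    link_nonneg (h1 {1}) (h1 {2}) (h1 {3}) x12 x13 x23
  have m0 : 0 ≤ h {0} * (6 - 2 * (β {1} + β {2} + β {3}) - ((β {1, 2} - β {1} * β {2}) + (β {1, 3} - β {1} * β {3}) + (β {2, 3} - β {2} * β {3}))
      + 2 * (min 0 (β {1, 2} - β {1} * β {2}) + min 0 (β {1, 3} - β {1} * β {3}) + min 0 (β {2, 3} - β {2} * β {3}))) := mul_nonneg (hh0 {0}) l0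
  have l1 : 0 ≤ 6 - 2 * (β {0} + β {2} + β {3}) - ((β {0, 2} - β {0} * β {2}) + (β {0, 3} - β {0} * β {3}) + (β {2, 3} - β {2} * β {3}))
      + 2 * (min 0 (β {0, 2} - β {0} * β {2}) + min 0 (β {0, 3} - β {0} * β {3}) + min 0 (β {2, 3} - β {2} * β {3})) :=
    link_nonneg (h1 {0}) (h1 {2}) (h1 {3}) x02 x03 x23
  have m1 : 0 ≤ h {1} * (6 - 2 * (β {0} + β {2} + β {3}) - ((β {0, 2} - β {0} * β {2}) + (β {0, 3} - β {0} * β {3}) + (β {2, 3} - β {2} * β {3}))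
      + 2 * (min 0 (β {0, 2} - β {0} * β {2}) + min 0 (β {0, 3} - β {0} * β {3}) + min 0 (β {2, 3} - β {2} * β {3}))) := mul_nonneg (hh0 {1}) l1
  have l2 : 0 ≤ 6 - 2 * (β {0} + β {1} + β {3}) - ((β {0, 1} - β {0} * β {1}) + (β {0, 3} - β {0} * β {3}) + (β {1, 3} - β {1} * β {3}))
      + 2 * (min 0 (β {0, 1} - β {0} * β {1}) + min 0 (β {0, 3} - β {0} * β {3}) + min 0 (β {1, 3} - β {1} * β {3})) :=
    link_nonneg (h1 {0}) (h1 {1}) (h1 {3}) x01 x03 x13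
  have m2 : 0 ≤ h {2} * (6 - 2 * (β {0} + β {1} + β {3}) - ((β {0, 1} - β {0} * β {1}) + (β {0, 3} - β {0} * β {3}) + (β {1, 3} - β {1} * β {3}))
      + 2 * (min 0 (β {0, 1} - β {0} * β {1}) + min 0 (β {0, 3} - β {0} * β {3}) + min 0 (β {1, 3} - β {1} * β {3}))) := mul_nonneg (hh0 {2}) l2
  have l3 : 0 ≤ 6 - 2 * (β {0} + β {1} + β {2}) - ((β {0, 1} - β {0} * β {1}) + (β {0, 2} - β {0} * β {2}) + (β {1, 2} - β {1} * β {2}))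
      + 2 * (min 0 (β {0, 1} - β {0} * β {1}) + min 0 (β {0, 2} - β {0} * β {2}) + min 0 (β {1, 2} - β {1} * β {2})) :=
    link_nonneg (h1 {0}) (h1 {1}) (h1 {2}) x01 x02 x12
  have m3 : 0 ≤ h {3} * (6 - 2 * (β {0} + β {1} + β {2}) - ((β {0, 1} - β {0} * β {1}) + (β {0, 2} - β {0} * β {2}) + (β {1, 2} - β {1} * β {2}))
      + 2 * (min 0 (β {0, 1} - β {0} * β {1}) + min 0 (β {0, 2} - β {0} * β {2}) + min 0 (β {1, 2} - β {1} * β {2}))) := mul_nonneg (hh0 {3}) l3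
  have r0 : 0 ≤ h {1, 2, 3} * (6 * β {0}) := mul_nonneg (hh0 {1, 2, 3}) (by linarith [h0 {0}])
  have r1 : 0 ≤ h {0, 2, 3} * (6 * β {1}) := mul_nonneg (hh0 {0, 2, 3}) (by linarith [h0 {1}])
  have r2 : 0 ≤ h {0, 1, 3} * (6 * β {2}) := mul_nonneg (hh0 {0, 1, 3}) (by linarith [h0 {2}])
  have r3 : 0 ≤ h {0, 1, 2} * (6 * β {3}) := mul_nonneg (hh0 {0, 1, 2}) (by linarith [h0 {3}])
  linarith [q01, q02, q03, q12, q13, q23, m0, m1, m2, m3, r0, r1, r2, r3]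

/-- **BILIN(4)**. [this work] -/
theorem bilin_four : Bilin 4 := fun h hh0 hsub htop β h0 h1 _ hu => bil_four_nonneg_of_pairUnion h hh0 hsub htop β h0 h1 hu

/-- SDH♭-LIN(4) recovered through the roof (consistency check of the ladder). [this work] -/
theorem sdhFlatLin_four' : SDHFlatLin 4 := sdhFlatLin_of_bilin bilin_four

/-- H♭-LIN(4) recovered through the roof. [this work] -/
theorem hFlatLin_four' : HFlatLin 4 := hFlatLin_of_bilin bilin_four

end SDHFlat

end Summit.CriticalPhenomena.PercolationContinuityZ3.Theorems
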